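import Summits.ResolutionOfSingularities.ResolutionOfSingularities.Theorems.PurelyInseparableDim4ResConeBinaryPersist
import Summits.ResolutionOfSingularities.ResolutionOfSingularities.Theorems.PurelyInseparableDim4ResConeLayerBirths
import HarnessLib
import HarnessLib.Audit.Tags

/-!
# Purely inseparable four-folds — CORNER RIGIDITY at `e_G = 2`: with the residual cone free of the two active
# letters and the slot `x_a² · y^{d−1}` of `G` EMPTY, a pure corner in chart `a` that keeps `(d, e_G = 2)`
# reproduces the frame — `e_a, e_{a′}` stay in the new polar kernel, no re-straightening, no births
# (idea-4 CARD I-4-8 §A (TS2)/(A3) «w₂₀ + γ·∇B = 0 ⇒ γ = 0», kernel form; K2(p) lane, SLICE C (C7a),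
# file-holder res-dim4-p-5 g3)

[OURS · counted 0 · cell `res-dim4-pi` · K2(p) lane (desk WORDS #78 (d), #80 (d)) · seat res-dim4-p-5 g3.]
Nothing here proves K2(p), `NoIsolatedTrap p p` or resolution of singularities in dimension ≥ 4 /
characteristic `p`.

Setting (`…ResCone*`): a shade-keeping band step at the chart ORIGIN of the `x_a`-chart (`b = 0`), `x^r ∣ F`,
`p < ord₀ F = o ≤ 2p − 2` (isolated band), TAME residual degree `d = o − |r| < p`, two active letters `a ≠ a′` with
`resVertex s = ⟨e_a, e_{a′}⟩` (i.e. `e_G = 2` and the cone `g = resForm s` is a binary form in the two PASSIVE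
letters), and `e_G(s′) = 2` kept.  By `…ResConeLayerBirths` the new cone is
`g′ = c·(g + x_a·B₁ + x_a²·B₂ + …)`, the layer `B₁(x_{a′}, y)` being read off the monomials `x^r·x_a²·x_{a′}^j·y^ν`
of `F` with `j + |ν| = d − 1` (the face `α + 2β = 2` of Hironaka's polygon).  THE SLOT `(2,0)` is its `x_{a′}`-free
part: the monomials `x^r · x_a² · y^ν`, `|ν| = d − 1`.

* `inf_hyperplane_inf_hyperplane_eq_bot` — `⟨e_a, e_{a′}⟩ ∩ H_a ∩ H_{a′} = 0` for a plane containing `e_a, e_{a′}`;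
* `killVar_killVar_pderiv_resForm_step_eq_zero` — the slot hypothesis on `F` says
  `(∂_a g′)|_{x_a = x_{a′} = 0} = 0`;
* **`single_mem_resVertex_step_of_slot_empty`** (CORNER RIGIDITY): under the hypotheses above and the empty
  slot, `e_a ∈ resVertex s′` and `e_{a′} ∈ resVertex s′` — so `resVertex s′ = ⟨e_a, e_{a′}⟩` again and `g′` is
  free of `x_a, x_{a′}` (`…PolarFree`), the frame of `…ResConeCornerGame` REPRODUCES with no coordinate change.
  Proof: (I2) keeps `e_{a′}`; a transversal `ρ = e_a + γ ∈ resVertex s′` (`γ` passive) has `D_ρ g′ = 0`; killing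
  `x_a` gives `B₁ + c·D_γ g = 0` (`killVar_resForm_step`, `polarMap_killVar`), killing `x_{a′}` then gives
  `c·D_γ g = 0` (slot empty; `g`, `D_γ g` are free of `a′`), so `γ ∈ resVertex s ∩ H_a ∩ H_{a′} = 0`.
The slot is fed only by the `x_a`-AXIS of the polygon (pure powers `x_a^i·y^ν`, `i ≥ 3`, marching down under
`a`-steps and leaving the axis at every `a′`-step) — the bookkeeping of the next file (C7b).
[cite: CossartJannsenSaito2020, Thm. 3.10(4), Thm. 9.3, Lemma 13.2 (preparation along the face E_L)]
bears_on: LADDER-RESOLUTION:D157-DOOR2 (res-dim4-pi · K2(p) = `RidgeBudget.NoAboveFloorTrap p p` · slice C).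
Supports stmt-ResolutionOfSingularities-16155 (helper).
-/

set_option linter.dupNamespace false -- mandated namespace of this single-conjunct summit

noncomputable section

namespace Summit.ResolutionOfSingularities.ResolutionOfSingularities.Theorems.PIDim4

namespace ResCone

open MvPolynomial Finset
open Literature.AlgebraicGeometry.Resolution
open Literature.AlgebraicGeometry.Resolution.CentreBlowup
open Literature.AlgebraicGeometry.Resolution.Hauser2010
open Literature.AlgebraicGeometry.Resolution.HauserPerlega2019
open PointBlowup (polarMap additiveSubspace direction)

variable {K : Type} [Field K]

/-! ## 1. Linear algebra of the frame plane -/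

/-- A PLANE containing `e_a` and `e_{a′}` (`a ≠ a′`) meets `H_a ∩ H_{a′}` trivially: a vector of it with vanishing
`a`- and `a′`-coordinates is zero. [folklore] -/
theorem eq_zero_of_mem_of_finrank_eq_two {A : Submodule K (Fin 4 → K)} {a a' : Fin 4} (haa : a ≠ a')
    (he : Module.finrank K A = 2) (ha : (Pi.single a 1 : Fin 4 → K) ∈ A) (ha' : (Pi.single a' 1 : Fin 4 → K) ∈ A)
    {w : Fin 4 → K} (hw : w ∈ A) (hwa : w a = 0) (hwa' : w a' = 0) : w = 0 := by
  have h1 := finrank_inf_hyperplane_add_one A a ha (by rw [Pi.single_eq_same]; exact one_ne_zero)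
  have ha'2 : (Pi.single a' 1 : Fin 4 → K) ∈ A ⊓ hyperplane a :=
    Submodule.mem_inf.mpr ⟨ha', mem_hyperplane.mpr (by rw [Pi.single_eq_of_ne haa])⟩
  have h2 := finrank_inf_hyperplane_add_one (A ⊓ hyperplane a) a' ha'2
    (by rw [Pi.single_eq_same]; exact one_ne_zero)
  have h0 : Module.finrank K ↥(A ⊓ hyperplane a ⊓ hyperplane a') = 0 := by omega
  have hbot : A ⊓ hyperplane a ⊓ hyperplane a' = ⊥ := Submodule.finrank_eq_zero.mp h0
  have hmem : w ∈ A ⊓ hyperplane a ⊓ hyperplane a' :=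
    Submodule.mem_inf.mpr ⟨Submodule.mem_inf.mpr ⟨hw, mem_hyperplane.mpr hwa⟩, mem_hyperplane.mpr hwa'⟩
  rw [hbot] at hmem
  exact (Submodule.mem_bot K).mp hmem

/-! ## 2. The slot `(2,0)`: reading `(∂_a g′)|_{x_a = x_{a′} = 0}` on the parent -/

section Step

variable [DecidableEq K]

/-- **The `x_a, x_{a′}`-free part of `∂_a (resForm s′)` is the SLOT `(2,0)`** of the parent: at a shade-keeping
pure corner in chart `a` (band, `x^r ∣ F`), if `F` has no monomial `x^r · x_a² · y^ν` with `ν` passive of degree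
`d − 1`, then `(∂_a g′)|_{x_a = x_{a′} = 0} = 0` (`…LayerBirths`: layer `1` of `g′` is `c ×` the `x_a²`-layer of
`G_{d+1}`). [OURS] [cite: CossartJannsenSaito2020, Thm. 3.10(4), Thm. 9.3] -/
theorem killVar_killVar_pderiv_resForm_step_eq_zero {p : ℕ} {a a' : Fin 4} {s : State K}
    {o : ℕ} (ho : ordZero s.F = o) (hr : ∀ d ∈ s.F.support, s.r ≤ d) (hpo : p < o) (ho2 : o + 2 ≤ 2 * p)
    (heq : (CentreBlowup.step p Finset.univ a 0 s).shade = s.shade)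
    (hslot : ∀ ν : Fin 4 →₀ ℕ, ν a = 0 → ν a' = 0 → ν.degree + 1 = o - s.r.degree →
      coeff (s.r + ν + Finsupp.single a 2) s.F = 0) :
    PointBlowup.killVar a' (PointBlowup.killVar a
      (pderiv a (resForm (CentreBlowup.step p Finset.univ a 0 s)))) = 0 := by
  have hbj : (0 : Fin 4 → K) a = 0 := rfl
  have hhom := resForm_step_isHomogeneous a hbj ho hr heq
  ext ν
  rw [coeff_killVar, coeff_zero]
  split_ifs with hνa'
  · rw [coeff_killVar]
    split_ifs with hνa
    · rw [coeff_pderiv, hνa, Nat.cast_zero, zero_add, mul_one]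
      by_cases hdeg : (ν + Finsupp.single a 1).degree = o - s.r.degree
      · have hνa1 : (ν + Finsupp.single a 1 : Fin 4 →₀ ℕ) a = 1 := by
          rw [Finsupp.add_apply, hνa, Finsupp.single_eq_same]
        have hlt : o + (ν + Finsupp.single a 1 : Fin 4 →₀ ℕ) a < 2 * p := by rw [hνa1]; omega
        rw [coeff_resForm_step_eq_mul_coeff_shear_divMonomial_of_add_lt a hbj ho hr hpo heq hdeg hlt, hνa1]
        simp only [shear_zero]
        rw [add_assoc, ← Finsupp.single_add, one_add_one_eq_two, coeff_divMonomial, ← add_assoc,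
          hslot ν hνa hνa' (by rw [map_add, Finsupp.degree_single] at hdeg; exact hdeg), mul_zero]
      · exact hhom.coeff_eq_zero hdeg
    · rfl
  · rfl

/-! ## 3. Corner rigidity -/

/-- **CORNER RIGIDITY at `e_G = 2`** (idea-4 I-4-8 §A (A3), kernel form, every prime): at a shade-keeping pure
corner in chart `a` in the isolated band with tame residual degree, `resVertex s = ⟨e_a, e_{a′}⟩`,
`e_G(s′) = 2` and the slot `x^r·x_a²·y^{d−1}` of `F` empty, BOTH `e_a` and `e_{a′}` lie in `resVertex s′`: the frame
reproduces with no coordinate change (and `resForm s′ = c · resForm s`, no births). [OURS]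
[cite: CossartJannsenSaito2020, Thm. 3.10(4), Thm. 3.14, Thm. 9.3] -/
theorem single_mem_resVertex_step_of_slot_empty (p : ℕ) [Fact p.Prime] [CharP K p] {a a' : Fin 4}
    (haa : a ≠ a') {s : State K} {o : ℕ} (ho : ordZero s.F = o) (hr : ∀ d ∈ s.F.support, s.r ≤ d)
    (hpo : p < o) (ho2 : o + 2 ≤ 2 * p) (heq : (CentreBlowup.step p Finset.univ a 0 s).shade = s.shade)
    (hd : o - s.r.degree < p) (he : Module.finrank K (resVertex s) = 2)
    (ha : (Pi.single a 1 : Fin 4 → K) ∈ resVertex s) (ha' : (Pi.single a' 1 : Fin 4 → K) ∈ resVertex s)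
    (he' : Module.finrank K (resVertex (CentreBlowup.step p Finset.univ a 0 s)) = 2)
    (hslot : ∀ ν : Fin 4 →₀ ℕ, ν a = 0 → ν a' = 0 → ν.degree + 1 = o - s.r.degree →
      coeff (s.r + ν + Finsupp.single a 2) s.F = 0) :
    (Pi.single a 1 : Fin 4 → K) ∈ resVertex (CentreBlowup.step p Finset.univ a 0 s) ∧
      (Pi.single a' 1 : Fin 4 → K) ∈ resVertex (CentreBlowup.step p Finset.univ a 0 s) := by
  have hbj : (0 : Fin 4 → K) a = 0 := rfl
  have ho2' : o < 2 * p := by omega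
  set s' := CentreBlowup.step p Finset.univ a 0 s with hs'
  have hc : coeff (topMonomial a (0 : Fin 4 → K) s.r) (monomial s.r (1 : K)) ≠ 0 := by
    have h := coeff_topMonomial_ne_zero a hbj s.r
    rwa [shear_zero] at h
  -- (I2): `e_{a′}` persists
  have hI2 := resVertex_step_inf_hyperplane_eq_of_finrank_eq a hbj ho hr hpo ho2' heq (he'.trans he.symm)
  have ha'V' : (Pi.single a' 1 : Fin 4 → K) ∈ resVertex s' := by
    have hmem : (Pi.single a' 1 : Fin 4 → K) ∈ resVertex s ⊓ hyperplane a :=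
      Submodule.mem_inf.mpr ⟨ha', mem_hyperplane.mpr (by rw [Pi.single_eq_of_ne haa])⟩
    rw [← hI2] at hmem
    exact (Submodule.mem_inf.mp hmem).1
  refine ⟨?_, ha'V'⟩
  -- a transversal vector of the new kernel, normalised and cleared of its `a′`-component
  obtain ⟨u, hu, hua⟩ := exists_transversal_of_finrank_eq a hbj ho hr hpo ho2' heq (he'.trans he.symm)
  set γ : Fin 4 → K := u - u a' • Pi.single a' 1 - Pi.single a 1 with hγ
  have hγa : γ a = 0 := by
    simp only [hγ, Pi.sub_apply, Pi.smul_apply, Pi.single_eq_same, Pi.single_eq_of_ne haa, smul_eq_mul,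
      mul_zero, sub_zero, hua, sub_self]
  have hγa' : γ a' = 0 := by
    simp only [hγ, Pi.sub_apply, Pi.smul_apply, Pi.single_eq_same, Pi.single_eq_of_ne haa.symm, smul_eq_mul,
      mul_one, sub_self]
  have hρ : Pi.single a 1 + γ ∈ resVertex s' := by
    have : Pi.single a 1 + γ = u - u a' • Pi.single a' 1 := by rw [hγ]; abel
    rw [this]
    exact Submodule.sub_mem _ hu (Submodule.smul_mem _ _ ha'V')
  -- the polar identity `∂_a g′ + D_γ g′ = 0`, killed in `x_a`: `B₁-layer + c·D_γ g = 0`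
  have hpol : pderiv a (resForm s') + polarMap (resForm s') γ = 0 := by
    have h0 : polarMap (resForm s') (Pi.single a 1 + γ) = 0 := by
      have := hρ; unfold resVertex additiveSubspace at this; exact LinearMap.mem_ker.mp this
    rwa [map_add, polarMap_single] at h0
  have hfreea' : ∀ e ∈ (resForm s).support, e a' = 0 :=
    (single_mem_resVertex_iff_free p ho hd a').mp ha'
  have hkill : coeff (topMonomial a (0 : Fin 4 → K) s.r) (monomial s.r (1 : K)) • polarMap (resForm s) γ = 0 := by
    have h1 := congrArg (fun P => PointBlowup.killVar a' (PointBlowup.killVar a P)) hpol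
    simp only [map_add, map_zero] at h1
    rw [killVar_killVar_pderiv_resForm_step_eq_zero ho hr hpo ho2 heq hslot, zero_add,
      ← polarMap_killVar _ hγa, killVar_resForm_step a hbj ho hr hpo ho2' heq] at h1
    simp only [shear_zero] at h1
    rw [polarMap_smul_form, map_smul, ← polarMap_killVar _ hγa', killVar_eq_self_of_free hfreea'] at h1
    exact h1
  have hγV : γ ∈ resVertex s := by
    unfold resVertex additiveSubspace
    rw [LinearMap.mem_ker]
    exact (smul_eq_zero.mp hkill).resolve_left hc
  have hγ0 : γ = 0 := eq_zero_of_mem_of_finrank_eq_two haa he ha ha' hγV hγa hγa'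
  rw [hγ0, add_zero] at hρ
  exact hρ

/-- **Rigidity, cone form**: under the same hypotheses the new residual cone is again free of both active letters
(hence `= c · resForm s` by `…BinaryPersist`). [OURS] [cite: CossartJannsenSaito2020, Thm. 3.10(4), Thm. 9.3] -/
theorem free_resForm_step_of_slot_empty (p : ℕ) [Fact p.Prime] [CharP K p] {a a' : Fin 4} (haa : a ≠ a')
    {s : State K} {o : ℕ} (ho : ordZero s.F = o) (hr : ∀ d ∈ s.F.support, s.r ≤ d) (hpo : p < o)
    (ho2 : o + 2 ≤ 2 * p) (heq : (CentreBlowup.step p Finset.univ a 0 s).shade = s.shade)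
    (hd : o - s.r.degree < p) (he : Module.finrank K (resVertex s) = 2)
    (ha : (Pi.single a 1 : Fin 4 → K) ∈ resVertex s) (ha' : (Pi.single a' 1 : Fin 4 → K) ∈ resVertex s)
    (he' : Module.finrank K (resVertex (CentreBlowup.step p Finset.univ a 0 s)) = 2)
    (hslot : ∀ ν : Fin 4 →₀ ℕ, ν a = 0 → ν a' = 0 → ν.degree + 1 = o - s.r.degree →
      coeff (s.r + ν + Finsupp.single a 2) s.F = 0) :
    ∀ μ ∈ (resForm (CentreBlowup.step p Finset.univ a 0 s)).support, μ a = 0 ∧ μ a' = 0 := by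
  have hbj : (0 : Fin 4 → K) a = 0 := rfl
  obtain ⟨haV', ha'V'⟩ := single_mem_resVertex_step_of_slot_empty p haa ho hr hpo ho2 heq hd he ha ha' he' hslot
  have ho' := ordZero_step_of_shade_eq a hbj ho hr heq
  have hd' : ((CentreBlowup.step p Finset.univ a 0 s).r.degree + (o - s.r.degree)) -
      (CentreBlowup.step p Finset.univ a 0 s).r.degree < p := by rwa [Nat.add_sub_cancel_left]
  intro μ hμ
  exact ⟨(single_mem_resVertex_iff_free p ho' hd' a).mp haV' μ hμ,
    (single_mem_resVertex_iff_free p ho' hd' a').mp ha'V' μ hμ⟩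

end Step

end ResCone

end Summit.ResolutionOfSingularities.ResolutionOfSingularities.Theorems.PIDim4

end
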